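import Literature.NumberTheory.Automorphic.BianchiOrdinaryClassicality
import Mathlib.LinearAlgebra.PiTensorProduct.Basis
import HarnessLib

/-!
# The parallel-weight coefficients inside a tensor power: torus weights and unipotent triangularity

Topic `NumberTheory/Automorphic`; namespace `Literature.NumberTheory.Automorphic.ParallelWeight`.
Definitions with bodies and theorems (no named fact).

The parallel-weight representation `V_wt = ⨂_{τ : F → E} (S_μ(E²) ⊗ det^m) ∘ GL₂(τ)` of `GL₂(F)`
(`ParallelWeight.coeffRep`, `μ = coeffPartition wt ⊢ d = coeffDegree wt`, `m = lowestEntry wt`)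
embeds `GL₂(F)`-equivariantly into the **ambient tensor representation**

  `𝕋 = ⨂_{τ} ((E²)^{⊗ d} ⊗ det^m) ∘ GL₂(τ)`       (`TensorAmbient`, `ambientRep`),

by the tensor product of the inclusions of the Weyl modules (`coeffToAmbient`, injective:
`coeffToAmbient_injective`; equivariant: `coeffToAmbient_coeffRep`).  The ambient representation has
the explicit basis `w_I = ⨂_τ ⨂_i e_{I τ i}`, `I : (F → E) → (Fin d → Fin 2)` (`ambientBasis`), in
which every `g ∈ GL₂(F)` has the matrix coefficients (`ambientBasis_repr_rho`)

  `⟨ρ(g) w_I, w_J⟩ = ∏_τ τ(det g)^m · ∏_{τ, i} τ(g_{J τ i, I τ i})`.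

Consequently the diagonal torus acts diagonally by the algebraic characters
`χ_I(g) = ∏_τ τ(det g)^m ∏_{τ,i} τ(g_{I τ i, I τ i})` (`ambientRep_basis_of_isDiag`), and the upper
unipotent matrices act unitriangularly for the order "number of indices equal to `1`"
(`ambientRep_basis_sub_mem_span_of_unipotent`, with the injective refinement `ambRank`).  This is the
input for the dévissage `Literature.Algebra.Homology.scalarFiltered_sub_of_ambient` computing the torus
eigencharacters on the cohomology of the unipotent arithmetic groups [Harder1987, §2].

## References

* G. Harder, *Eisenstein cohomology of arithmetic groups. The case GL₂*, Invent. Math. 89 (1987), §2.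
  [Harder1987]
* W. Fulton, J. Harris, *Representation Theory*, GTM 129, §6.1, §15.5. [FultonHarrisGTM129]
-/

noncomputable section

open scoped TensorProduct
open Module Literature.NumberTheory.DiophantineGeometry

namespace Literature.NumberTheory.Automorphic.ParallelWeight

variable (E : Type) [Field E] (F : Type) [Field F] (d : ℕ) (m : ℤ)

/-! ### The ambient tensor representation -/

/-- **`𝕋 = ⨂_{τ : F → E} (E²)^{⊗d}`**, the ambient tensor space. [folklore] -/
abbrev TensorAmbient : Type := ⨂[E] _τ : (F →+* E), TensorPower E d (Fin 2 → E)

/-- The factor at `τ`: `((E²)^{⊗d} ⊗ det^m) ∘ GL₂(τ)`. [folklore] -/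
def ambientFactorRep (τ : F →+* E) : Representation E (GL (Fin 2) F) (TensorPower E d (Fin 2 → E)) :=
  (GLnCohomology.detTwist E m (glTensorRep (Fin 2) E d)).comp (Matrix.GeneralLinearGroup.map τ)

/-- Unfolding `ambientFactorRep`. [folklore] -/
theorem ambientFactorRep_apply (τ : F →+* E) (g : GL (Fin 2) F) (v : TensorPower E d (Fin 2 → E)) :
    ambientFactorRep E F d m τ g v =
      ((Matrix.GeneralLinearGroup.det (Matrix.GeneralLinearGroup.map τ g) ^ m : Eˣ) : E) •
        glTensorRep (Fin 2) E d (Matrix.GeneralLinearGroup.map τ g) v := rfl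

/-- **The ambient representation `ρ_𝕋(g) = ⨂_τ (τ(det g)^m · (τ g)^{⊗d})` of `GL₂(F)`.**
[cite: Harder1987, §2] -/
def ambientRep : Representation E (GL (Fin 2) F) (TensorAmbient E F d) :=
  PiTensorProduct.mapMonoidHom.comp (MonoidHom.pi fun τ : F →+* E => ambientFactorRep E F d m τ)

/-- `ρ_𝕋(g)` on pure tensors. [folklore] -/
theorem ambientRep_apply_tprod (g : GL (Fin 2) F) (v : (F →+* E) → TensorPower E d (Fin 2 → E)) :
    ambientRep E F d m g (PiTensorProduct.tprod E v) =
      PiTensorProduct.tprod E fun τ => ambientFactorRep E F d m τ g (v τ) := by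
  change PiTensorProduct.map _ _ = _
  exact PiTensorProduct.map_tprod _ _

/-- `ρ_𝕋(g)` is `PiTensorProduct.map` of the factors. [folklore] -/
theorem ambientRep_eq_map (g : GL (Fin 2) F) :
    (ambientRep E F d m g : TensorAmbient E F d →ₗ[E] TensorAmbient E F d) =
      PiTensorProduct.map fun τ => (ambientFactorRep E F d m τ g : _ →ₗ[E] _) := rfl

/-! ### The standard basis and the matrix coefficients -/

section StdBasis

open scoped Classical

/-- The standard basis `⨂_i e_{K i}` of `(E²)^{⊗d}`. [folklore] -/
def innerBasis : Module.Basis (Fin d → Fin 2) E (TensorPower E d (Fin 2 → E)) :=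
  Basis.piTensorProduct fun _ : Fin d => Pi.basisFun E (Fin 2)

/-- `innerBasis` on an index. [folklore] -/
theorem innerBasis_apply (K : Fin d → Fin 2) :
    innerBasis E d K = PiTensorProduct.tprod E fun i => (Pi.single (K i) (1 : E) : Fin 2 → E) := by
  rw [innerBasis, Basis.piTensorProduct_apply]
  simp only [Pi.basisFun_apply]

/-- The coordinates of `(τ g) e_K`-tensors: `⟨(τ g)^{⊗d} e_K, e_{K'}⟩ = ∏_i τ(g_{K' i, K i})`. [folklore] -/
theorem innerBasis_repr_glTensorRep (τ : F →+* E) (g : GL (Fin 2) F) (K K' : Fin d → Fin 2) :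
    (innerBasis E d).repr (glTensorRep (Fin 2) E d (Matrix.GeneralLinearGroup.map τ g) (innerBasis E d K)) K' =
      ∏ i : Fin d, τ ((g : Matrix (Fin 2) (Fin 2) F) (K' i) (K i)) := by
  rw [innerBasis_apply, glTensorRep_tprod, innerBasis, Basis.piTensorProduct_repr_tprod_apply]
  refine Finset.prod_congr rfl fun i _ => ?_
  rw [Pi.basisFun_repr, Matrix.mulVec_single_one, Matrix.col_apply]
  rfl

variable [NumberField F] [CharZero E]

/-- The index set of the standard basis of `𝕋`. [folklore] -/
abbrev AmbIdx : Type := (F →+* E) → (Fin d → Fin 2)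

/-- **The standard basis `w_I = ⨂_τ ⨂_i e_{I τ i}` of `𝕋`.** [folklore] -/
def ambientBasis : Module.Basis (AmbIdx E F d) E (TensorAmbient E F d) :=
  Basis.piTensorProduct fun _ : F →+* E => innerBasis E d

/-- `ambientBasis` on an index. [folklore] -/
theorem ambientBasis_apply (I : AmbIdx E F d) :
    ambientBasis E F d I = PiTensorProduct.tprod E fun τ => innerBasis E d (I τ) := by
  rw [ambientBasis, Basis.piTensorProduct_apply]

/-- **The matrix coefficients of `ρ_𝕋(g)` in the standard basis**:
`⟨ρ_𝕋(g) w_I, w_J⟩ = ∏_τ τ(det g)^m · ∏_{τ,i} τ(g_{J τ i, I τ i})`. [cite: Harder1987, §2] -/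
theorem ambientBasis_repr_rho (g : GL (Fin 2) F) (I J : AmbIdx E F d) :
    (ambientBasis E F d).repr (ambientRep E F d m g (ambientBasis E F d I)) J =
      (∏ τ : F →+* E, ((Matrix.GeneralLinearGroup.det (Matrix.GeneralLinearGroup.map τ g) ^ m : Eˣ) : E)) *
        ∏ τ : F →+* E, ∏ i : Fin d, τ ((g : Matrix (Fin 2) (Fin 2) F) (J τ i) (I τ i)) := by
  rw [ambientBasis_apply, ambientRep_apply_tprod]
  simp_rw [ambientFactorRep_apply]
  rw [MultilinearMap.map_smul_univ, map_smul, Finsupp.smul_apply, smul_eq_mul, ambientBasis,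
    Basis.piTensorProduct_repr_tprod_apply]
  simp_rw [innerBasis_repr_glTensorRep]

/-- The character `χ_I(g) = ∏_τ τ(det g)^m ∏_{τ,i} τ(g_{IτI, Iτi})` of the diagonal torus on `w_I`.
[folklore] -/
def ambientChar (I : AmbIdx E F d) (g : GL (Fin 2) F) : E :=
  (∏ τ : F →+* E, ((Matrix.GeneralLinearGroup.det (Matrix.GeneralLinearGroup.map τ g) ^ m : Eˣ) : E)) *
    ∏ τ : F →+* E, ∏ i : Fin d, τ ((g : Matrix (Fin 2) (Fin 2) F) (I τ i) (I τ i))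

/-- **Diagonal matrices act diagonally**: `ρ_𝕋(t) w_I = χ_I(t) w_I`. [cite: Harder1987, §2] -/
theorem ambientRep_basis_of_isDiag (g : GL (Fin 2) F)
    (hdiag : ∀ a b : Fin 2, a ≠ b → (g : Matrix (Fin 2) (Fin 2) F) a b = 0) (I : AmbIdx E F d) :
    ambientRep E F d m g (ambientBasis E F d I) = ambientChar E F d m I g • ambientBasis E F d I := by
  classical
  refine (ambientBasis E F d).ext_elem fun J => ?_
  rw [ambientBasis_repr_rho, map_smul, Finsupp.smul_apply, Module.Basis.repr_self, smul_eq_mul,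
    Finsupp.single_apply]
  by_cases hJ : I = J
  · subst hJ
    rw [if_pos rfl, mul_one]
    rfl
  · rw [if_neg hJ, mul_zero]
    obtain ⟨τ, hτ⟩ := Function.ne_iff.1 (Ne.symm hJ)
    obtain ⟨i, hi⟩ := Function.ne_iff.1 hτ
    refine mul_eq_zero_of_right _ (Finset.prod_eq_zero (Finset.mem_univ τ)
      (Finset.prod_eq_zero (Finset.mem_univ i) ?_))
    rw [hdiag _ _ hi, map_zero]

/-- The number of indices equal to `1`. [folklore] -/
def ones (I : AmbIdx E F d) : ℕ := ∑ τ : F →+* E, ∑ i : Fin d, ((I τ i : Fin 2) : ℕ)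

/-- `J ≤ I` pointwise and `J ≠ I` forces `ones J < ones I`. [folklore] -/
theorem ones_lt_of_le_of_ne {I J : AmbIdx E F d} (hle : ∀ τ i, J τ i ≤ I τ i) (hne : J ≠ I) :
    ones E F d J < ones E F d I := by
  obtain ⟨τ₀, hτ⟩ := Function.ne_iff.1 hne
  obtain ⟨i₀, hi⟩ := Function.ne_iff.1 hτ
  refine Finset.sum_lt_sum (fun τ _ => Finset.sum_le_sum fun i _ => Fin.val_fin_le.2 (hle τ i))
    ⟨τ₀, Finset.mem_univ _, Finset.sum_lt_sum (fun i _ => Fin.val_fin_le.2 (hle τ₀ i))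
      ⟨i₀, Finset.mem_univ _, Fin.val_fin_lt.2 (lt_of_le_of_ne (hle τ₀ i₀) hi)⟩⟩

/-- An injective refinement of `ones`: `rank I = ones I · (#indices + 1) + (number of I)`. [folklore] -/
def ambRank (I : AmbIdx E F d) : ℕ :=
  ones E F d I * (Fintype.card (AmbIdx E F d) + 1) + (Fintype.equivFin (AmbIdx E F d) I : ℕ)

/-- `ambRank` modulo `#indices + 1` is the enumeration. [folklore] -/
theorem ambRank_mod (K : AmbIdx E F d) :
    ambRank E F d K % (Fintype.card (AmbIdx E F d) + 1) = (Fintype.equivFin (AmbIdx E F d) K : ℕ) := by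
  rw [ambRank, add_comm, Nat.add_mul_mod_self_right,
    Nat.mod_eq_of_lt (Nat.lt_succ_of_lt (Fintype.equivFin _ K).2)]

/-- `ambRank` is injective. [folklore] -/
theorem ambRank_injective : Function.Injective (ambRank E F d) := by
  intro I J h
  have hI := ambRank_mod E F d I
  rw [h, ambRank_mod] at hI
  exact (Fintype.equivFin (AmbIdx E F d)).injective (Fin.ext hI).symm

/-- Fewer ones means smaller rank. [folklore] -/
theorem ambRank_lt_of_ones_lt {I J : AmbIdx E F d} (h : ones E F d J < ones E F d I) :
    ambRank E F d J < ambRank E F d I := by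
  have hJ : (Fintype.equivFin (AmbIdx E F d) J : ℕ) < Fintype.card (AmbIdx E F d) + 1 :=
    Nat.lt_succ_of_lt (Fintype.equivFin _ J).2
  unfold ambRank
  calc ones E F d J * (Fintype.card (AmbIdx E F d) + 1) + (Fintype.equivFin (AmbIdx E F d) J : ℕ)
      < ones E F d J * (Fintype.card (AmbIdx E F d) + 1) + (Fintype.card (AmbIdx E F d) + 1) :=
        Nat.add_lt_add_left hJ _
    _ = (ones E F d J + 1) * (Fintype.card (AmbIdx E F d) + 1) := by ring
    _ ≤ ones E F d I * (Fintype.card (AmbIdx E F d) + 1) := Nat.mul_le_mul_right _ h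
    _ ≤ _ := Nat.le_add_right _ _

/-- **Upper unitriangular matrices act unitriangularly**: for `u = (1 β; 0 1)`,
`ρ_𝕋(u) w_I - w_I` is a combination of the `w_J` with fewer ones (`rank J < rank I`).
[cite: Harder1987, §2] -/
theorem ambientRep_basis_sub_mem_span_of_unipotent (g : GL (Fin 2) F)
    (h00 : (g : Matrix (Fin 2) (Fin 2) F) 0 0 = 1) (h11 : (g : Matrix (Fin 2) (Fin 2) F) 1 1 = 1)
    (h10 : (g : Matrix (Fin 2) (Fin 2) F) 1 0 = 0) (I : AmbIdx E F d) :
    ambientRep E F d m g (ambientBasis E F d I) - ambientBasis E F d I ∈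
      Submodule.span E (ambientBasis E F d '' {J | ambRank E F d J < ambRank E F d I}) := by
  classical
  rw [Module.Basis.mem_span_image]
  intro J hJ
  rw [Finset.mem_coe, Finsupp.mem_support_iff, map_sub, Finsupp.sub_apply, Module.Basis.repr_self,
    ambientBasis_repr_rho, Finsupp.single_apply] at hJ
  -- the determinant twist is `1`
  have hdet : ∀ τ : F →+* E, Matrix.GeneralLinearGroup.det (Matrix.GeneralLinearGroup.map τ g) = 1 := by
    intro τ
    ext
    rw [Matrix.GeneralLinearGroup.val_det_apply, Units.val_one]
    change ((g : Matrix (Fin 2) (Fin 2) F).map τ).det = 1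
    rw [Matrix.det_fin_two]
    simp only [Matrix.map_apply, h00, h11, h10, map_one, map_zero, mul_one, mul_zero, sub_zero]
  simp_rw [hdet, one_zpow, Units.val_one, Finset.prod_const_one, one_mul] at hJ
  change ambRank E F d J < ambRank E F d I
  by_cases hIJ : I = J
  · subst hIJ
    refine absurd ?_ hJ
    rw [if_pos rfl, sub_eq_zero]
    refine Finset.prod_eq_one fun τ _ => Finset.prod_eq_one fun i _ => ?_
    have hdiag1 : ∀ a : Fin 2, τ ((g : Matrix (Fin 2) (Fin 2) F) a a) = 1 := by
      intro a
      fin_cases a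
      · simp [h00]
      · simp [h11]
    exact hdiag1 _
  · rw [if_neg hIJ, sub_zero] at hJ
    -- every factor `τ(g_{Jτi, Iτi})` is non-zero, so `(J τ i, I τ i) ≠ (1, 0)`: `J ≤ I`
    have hle : ∀ τ i, J τ i ≤ I τ i := by
      intro τ i
      by_contra hlt
      push Not at hlt
      have hv := Fin.lt_def.1 hlt
      have hJlt := (J τ i).isLt
      have hI0 : I τ i = 0 := Fin.ext (by simp only [Fin.val_zero]; omega)
      have hJ1 : J τ i = 1 := Fin.ext (by simp only [Fin.val_one]; omega)
      refine hJ (Finset.prod_eq_zero (Finset.mem_univ τ) (Finset.prod_eq_zero (Finset.mem_univ i) ?_))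
      rw [hI0, hJ1, h10, map_zero]
    exact ambRank_lt_of_ones_lt E F d (ones_lt_of_le_of_ne E F d hle (Ne.symm hIJ))

/-- The standard basis spans. [folklore] -/
theorem span_range_ambientBasis : Submodule.span E (Set.range (ambientBasis E F d)) = ⊤ :=
  (ambientBasis E F d).span_eq

end StdBasis

/-! ### The embedding of `V_wt` -/

section Embedding

variable (wt : Fin 2 → ℤ)

/-- The inclusion `V_wt(E) = S_μ(E²) ⊗ det^m ⊆ (E²)^{⊗d}` as a linear map out of the tree's
`GLnCohomology.CoeffModule`. [folklore] -/
def coeffIncl : GLnCohomology.CoeffModule E 2 wt →ₗ[E] TensorPower E (GLnCohomology.coeffDegree wt) (Fin 2 → E) where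
  toFun w := ((show weylModule E (Fin 2) (GLnCohomology.coeffPartition wt) from w) :
    TensorPower E (GLnCohomology.coeffDegree wt) (Fin 2 → E))
  map_add' _ _ := rfl
  map_smul' _ _ := rfl

/-- Unfolding `coeffIncl`: the underlying tensor. [folklore] -/
theorem coeffIncl_apply (w : GLnCohomology.CoeffModule E 2 wt) :
    coeffIncl E wt w = ((show weylModule E (Fin 2) (GLnCohomology.coeffPartition wt) from w) :
      TensorPower E (GLnCohomology.coeffDegree wt) (Fin 2 → E)) := rfl

/-- `coeffIncl` is injective. [folklore] -/
theorem coeffIncl_injective : Function.Injective (coeffIncl E wt) := fun _ _ h => Subtype.ext (by exact h)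

/-- The inclusion intertwines `V_wt(h)` with `det(h)^m h^{⊗d}`. [folklore] -/
theorem coeffIncl_comp_coeffRepGL (h : GL (Fin 2) E) :
    coeffIncl E wt ∘ₗ (GLnCohomology.coeffRepGL E 2 wt h : GLnCohomology.CoeffModule E 2 wt →ₗ[E] _) =
      (GLnCohomology.detTwist E (GLnCohomology.lowestEntry wt)
          (glTensorRep (Fin 2) E (GLnCohomology.coeffDegree wt)) h : _ →ₗ[E] _) ∘ₗ coeffIncl E wt := by
  refine LinearMap.ext fun w => ?_
  rw [LinearMap.comp_apply, LinearMap.comp_apply, GLnCohomology.coeffRepGL_apply, map_smul,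
    GLnCohomology.detTwist_apply]
  congr 1

/-- **The embedding `V_wt ↪ 𝕋`**: the tensor product of the inclusions of the Weyl modules
`S_μ(E²) ⊆ (E²)^{⊗d}`. [cite: FultonHarrisGTM129, §6.1] -/
def coeffToAmbient : CoeffModule E F 2 wt →ₗ[E] TensorAmbient E F (GLnCohomology.coeffDegree wt) :=
  show (⨂[E] _τ : (F →+* E), GLnCohomology.CoeffModule E 2 wt) →ₗ[E]
      (⨂[E] _τ : (F →+* E), TensorPower E (GLnCohomology.coeffDegree wt) (Fin 2 → E)) from
    PiTensorProduct.map fun _ : F →+* E => coeffIncl E wt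

/-- `coeffToAmbient` on pure tensors. [folklore] -/
theorem coeffToAmbient_tprod (v : (F →+* E) → GLnCohomology.CoeffModule E 2 wt) :
    coeffToAmbient E F wt (PiTensorProduct.tprod E v) = PiTensorProduct.tprod E fun τ => coeffIncl E wt (v τ) :=
  PiTensorProduct.map_tprod _ _

/-- **`V_wt ↪ 𝕋` is injective** (each inclusion of a Weyl module is split). [folklore] -/
theorem coeffToAmbient_injective : Function.Injective (coeffToAmbient E F wt) := by
  obtain ⟨r, hr⟩ := (coeffIncl E wt).exists_leftInverse_of_injective
    (LinearMap.ker_eq_bot.2 (coeffIncl_injective E wt))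
  have hcomp : (PiTensorProduct.map fun _ : F →+* E => r) ∘ₗ coeffToAmbient E F wt = LinearMap.id := by
    change (PiTensorProduct.map fun _ : F →+* E => r) ∘ₗ (PiTensorProduct.map fun _ : F →+* E => coeffIncl E wt) =
      LinearMap.id
    rw [← PiTensorProduct.map_comp]
    simp_rw [hr]
    exact PiTensorProduct.map_id
  intro a b hab
  have := congrArg (PiTensorProduct.map fun _ : F →+* E => r) hab
  change ((PiTensorProduct.map fun _ : F →+* E => r) ∘ₗ coeffToAmbient E F wt) a =
    ((PiTensorProduct.map fun _ : F →+* E => r) ∘ₗ coeffToAmbient E F wt) b at this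
  rwa [hcomp] at this

/-- **`V_wt ↪ 𝕋` is `GL₂(F)`-equivariant.** [cite: Harder1987, §2] -/
theorem coeffToAmbient_coeffRep (g : GL (Fin 2) F) (v : CoeffModule E F 2 wt) :
    coeffToAmbient E F wt (coeffRep E F 2 wt g v) =
      ambientRep E F (GLnCohomology.coeffDegree wt) (GLnCohomology.lowestEntry wt) g (coeffToAmbient E F wt v) := by
  have h1 : (coeffToAmbient E F wt) ∘ₗ (coeffRep E F 2 wt g : CoeffModule E F 2 wt →ₗ[E] _) =
      (ambientRep E F (GLnCohomology.coeffDegree wt) (GLnCohomology.lowestEntry wt) g : _ →ₗ[E] _) ∘ₗ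
        coeffToAmbient E F wt := by
    change (PiTensorProduct.map fun _ : F →+* E => coeffIncl E wt) ∘ₗ
        (PiTensorProduct.map fun τ : F →+* E =>
          (GLnCohomology.coeffRepGL E 2 wt (Matrix.GeneralLinearGroup.map τ g) : _ →ₗ[E] _)) =
      (PiTensorProduct.map fun τ : F →+* E =>
          (ambientFactorRep E F (GLnCohomology.coeffDegree wt) (GLnCohomology.lowestEntry wt) τ g : _ →ₗ[E] _)) ∘ₗ
        (PiTensorProduct.map fun _ : F →+* E => coeffIncl E wt)
    rw [← PiTensorProduct.map_comp, ← PiTensorProduct.map_comp]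
    congr 1
  exact LinearMap.congr_fun h1 v

end Embedding

end Literature.NumberTheory.Automorphic.ParallelWeight
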